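import Literature.Analysis.FluidPDE.WeakSpatialGradientSum
import Literature.Analysis.FunctionSpaces.BMOCarlesonFeffermanStein
import Literature.Analysis.UnboundedOperators.HeatFlowCalculus
import Literature.Analysis.UnboundedOperators.HeatKernelGaussianData
import Mathlib.Analysis.SpecialFunctions.JapaneseBracket
import HarnessLib

/-!
# Uniformly local enstrophy of the caloric extension: `L¹ ∩ L²` data and bounded `L^q` data

Analysis/FluidPDE proof file (theorems only), second step of the discharge of the named fact
`Literature.Analysis.FluidPDE.bradshawTsai2017_caloric_localLeray` (`CaloricLocalLeray.lean`;
Bradshaw–Tsai, Ann. Henri Poincaré 18 (2017) [BT1], §4: "`v₀ ∈ L²_uloc` implies `e^{tΔ}v₀` has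
uniformly locally finite energy and enstrophy"). It proves the **enstrophy box bound**
`sup_{x₀} ∫₀^{T}∫_{B_R(x₀)} |∇e^{tΔ}f|²_F < ∞` for the classical gradient of the caloric extension
`e^{tΔ}f = Literature.Analysis.UnboundedOperators.heatExtension f` of a vector field
`f : E → E` on a finite-dimensional real inner product space, for the two kinds of data produced
by the splitting `L³_w ⊂ (L¹ ∩ L²) + (L⁴ ∩ L^∞)`:

* `lintegral_Ioi_lintegral_frobeniusNormSq_fderiv_heatExtension_le` — the **vector energy
  inequality** `∫₀^∞ ∫ |∇e^{tΔ}f|²_F dy dt ≤ ½ ‖f‖₂²` for `f ∈ L¹ ∩ L²(E; E)`: componentwise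
  reduction (`frobeniusNormSq_fderiv_heatExtension_eq_sum`: `|∇e^{tΔ}f(y)|²_F = Σⱼ |∇e^{tΔ}fⱼ(y)|²`,
  `fⱼ = ⟪f, eⱼ⟫`) to the scalar energy inequality of the Koch–Tataru/Fefferman–Stein cluster
  (`Literature.Analysis.FunctionSpaces.BMOInv.lintegral_Ioi_lintegral_enorm_heatExtensionGrad_sq_le`,
  Plancherel), through the bridge `∂ᵥ e^{tΔ}g = ⟪∇e^{tΔ}g, v⟫` between the convolution calculus of
  `HeatFlowCalculus` and the kernel-defined gradient `BMOInv.heatExtensionGrad`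
  (`fderiv_heatExtension_apply_eq_inner_heatExtensionGrad`); hence the box bound
  `lintegral_box_frobeniusNormSq_fderiv_heatExtension_le`.
* `enorm_fderiv_heatExtension_apply_le_far` — the **far-field bound**: if `|h| ≤ M`, `h ∈ L^q`
  and `h = 0` on `B_{2R}(x₀)`, then `|∂ᵥe^{tΔ}h(y)| ≤ ‖v‖ M · 2(d+2)! 2^{d+1} (1+(2R)⁻¹)^{d+1}
  ∫(1+|w|)^{-(d+1)} dw` for `y ∈ B_R(x₀)`, uniformly in `t > 0` (kernel decay
  `‖w‖^{d+1}‖∇K_t(w)‖ ≤ 2(d+2)!`, `BMOInv.norm_heatKernelGrad_sub_le_far`; Grafakos, *Modern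
  Fourier Analysis*, proof of Thm 3.3.8 (b), far part).
* `exists_lintegral_box_frobeniusNormSq_le_of_integrable`,
  `exists_lintegral_box_frobeniusNormSq_le_of_bound` — the two box bounds in the form consumed by
  `isCaloricLocalLerayField_heatExtension_of_memLp` (`CaloricLocalLerayLp.lean`): for
  `f ∈ L¹ ∩ L²` globally from the energy inequality; for bounded `h ∈ L^q` by the near/far
  splitting `h = h𝟙_{B_{2R}(x₀)} + h𝟙_{B_{2R}(x₀)ᶜ}` per box (the near piece is in `L¹ ∩ L²` with
  `‖·‖₂² ≤ M²|B_{2R}|`, the far piece is pointwise bounded on the box).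

This is Lemarié-Rieusset, *The Navier–Stokes problem in the 21st century* (2016), proof of
Thm 14.1, Step 1, estimate (14.5) (`sup_x ‖∇⊗(W_t ∗ u₀)‖_{L²((0,T)×B(x,1))} ≤ C‖u₀‖_{L²_uloc}`),
organised as in Grafakos' proof of the Carleson-measure estimate for the heat extension.

## References

* Z. Bradshaw, T.-P. Tsai, Ann. Henri Poincaré 18 (2017) = arXiv:1510.07504, §4
  [BradshawTsai2017AHP].
* P. G. Lemarié-Rieusset, *The Navier–Stokes problem in the 21st century*, CRC Press 2016,
  Thm 14.1 (proof, Step 1, (14.5)) [LemarieRieusset2016].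
* L. Grafakos, *Modern Fourier Analysis*, 3rd ed., GTM 250 (2014), Thm 3.3.8 (b) [GrafakosMFA2014].
-/

noncomputable section

open MeasureTheory Set Function Filter Topology TopologicalSpace Metric InnerProductSpace
open scoped NNReal ENNReal RealInnerProductSpace Convolution

namespace Literature.Analysis.FluidPDE

open UnboundedOperators FunctionSpaces

variable {E : Type*} [NormedAddCommGroup E] [InnerProductSpace ℝ E] [FiniteDimensional ℝ E]
  [MeasurableSpace E] [BorelSpace E]

/-! ### Components of the caloric extension and of its gradient -/

section Components

variable {F : Type*} [NormedAddCommGroup F] [InnerProductSpace ℝ F]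

/-- The convolution integrand `z ↦ K_t(z) f(y − z)` of `e^{tΔ}f(y)` is integrable for
`f ∈ Lᵖ`, `1 ≤ p`, `t > 0` (Hölder against `K_t ∈ L^{p'}`). [folklore] -/
theorem integrable_heatKernel_smul_comp_sub_of_memLp {f : E → F} {p : ℝ≥0∞}
    (hf : MemLp f p volume) (hp : 1 ≤ p) {t : ℝ} (ht : 0 < t) (y : E) :
    Integrable (fun z => heatKernel t z • f (y - z)) := by
  haveI : p.HolderConjugate (ENNReal.conjExponent p) := .conjExponent hp
  have hq : 1 ≤ ENNReal.conjExponent p :=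
    ENNReal.HolderConjugate.one_le (ENNReal.conjExponent p) p
  have h := convolutionExistsAt_of_memLp (ContinuousLinearMap.lsmul ℝ ℝ)
    (memLp_heatKernel (E := E) ht hq) hf y
  simpa [ConvolutionExistsAt] using h

/-- **Additivity of the caloric extension on `Lᵖ + L^q` data** (pointwise, `t > 0`):
`e^{tΔ}(f + g)(y) = e^{tΔ}f(y) + e^{tΔ}g(y)` for `f ∈ Lᵖ`, `g ∈ L^q`, `1 ≤ p, q`. [folklore] -/
theorem heatExtension_add_apply_of_memLp {f g : E → F} {p q : ℝ≥0∞} (hf : MemLp f p volume)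
    (hg : MemLp g q volume) (hp : 1 ≤ p) (hq : 1 ≤ q) {t : ℝ} (ht : 0 < t) (y : E) :
    heatExtension (f + g) t y = heatExtension f t y + heatExtension g t y :=
  ConvolutionExistsAt.distrib_add (integrable_heatKernel_smul_comp_sub_of_memLp hf hp ht y)
    (integrable_heatKernel_smul_comp_sub_of_memLp hg hq ht y)

variable [CompleteSpace F]

/-- **Components of the caloric extension**: `e^{tΔ}⟪f, w⟫ (y) = ⟪e^{tΔ}f (y), w⟫` for `f ∈ Lᵖ`,
`1 ≤ p`, `t > 0`. [folklore] -/
theorem heatExtension_inner_const_apply {f : E → F} {p : ℝ≥0∞} (hf : MemLp f p volume)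
    (hp : 1 ≤ p) {t : ℝ} (ht : 0 < t) (y : E) (w : F) :
    heatExtension (fun z => ⟪f z, w⟫) t y = ⟪heatExtension f t y, w⟫ := by
  rw [heatExtension_apply, heatExtension_apply, real_inner_comm,
    ← integral_inner (integrable_heatKernel_smul_comp_sub_of_memLp hf hp ht y) w]
  refine integral_congr_ae (Eventually.of_forall fun z => ?_)
  simp only [real_inner_smul_right, smul_eq_mul, real_inner_comm]

/-- **Components of the gradient of the caloric extension**:
`⟪∂ᵥe^{tΔ}f (y), w⟫ = ∂ᵥ e^{tΔ}⟪f, w⟫ (y)` for `f ∈ Lᵖ`, `1 ≤ p`, `t > 0`. [folklore] -/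
theorem inner_fderiv_heatExtension_apply {f : E → F} {p : ℝ≥0∞} (hf : MemLp f p volume)
    (hp : 1 ≤ p) {t : ℝ} (ht : 0 < t) (y v : E) (w : F) :
    ⟪fderiv ℝ (heatExtension f t) y v, w⟫ =
      fderiv ℝ (heatExtension (fun z => ⟪f z, w⟫) t) y v := by
  have heq : heatExtension (fun z => ⟪f z, w⟫) t = fun y => ⟪heatExtension f t y, w⟫ :=
    funext fun y => heatExtension_inner_const_apply hf hp ht y w
  have hd : HasFDerivAt (heatExtension f t) (fderiv ℝ (heatExtension f t) y) y :=
    (hasFDerivAt_heatExtension hf hp ht y).differentiableAt.hasFDerivAt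
  have h1 : fderiv ℝ (fun y => ⟪heatExtension f t y, w⟫) y =
      (fderivInnerCLM ℝ (heatExtension f t y, w)).comp
        ((fderiv ℝ (heatExtension f t) y).prod (0 : E →L[ℝ] F)) :=
    (hd.inner ℝ (hasFDerivAt_const w y)).fderiv
  rw [heq, h1]
  simp only [ContinuousLinearMap.comp_apply, fderivInnerCLM_apply, ContinuousLinearMap.prod_apply,
    inner_zero_right, zero_add, FunLike.coe_zero, Pi.zero_apply]

end Components

/-! ### The bridge to the kernel-defined gradient and the vector energy inequality -/

section Energy

/-- **Bridge**: for scalar `g ∈ L¹ ∩ L²(E)` and `t > 0`, the Fréchet derivative of the caloric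
extension of the `UnboundedOperators` trunk is the kernel-defined gradient of the Koch–Tataru
cluster: `∂ᵥ e^{tΔ}g (y) = ⟪∇e^{tΔ}g (y), v⟫` (both are the convolution `g ∗ ∂ᵥK_t`). [folklore] -/
theorem fderiv_heatExtension_apply_eq_inner_heatExtensionGrad {g : E → ℝ} (hg1 : Integrable g)
    (hg2 : MemLp g 2 volume) {t : ℝ} (ht : 0 < t) (y v : E) :
    fderiv ℝ (heatExtension g t) y v = ⟪BMOInv.heatExtensionGrad g t y, v⟫ := by
  have hK : (fun z => fderiv ℝ (heatKernel t) z v) = fun w => ⟪BMOInv.heatKernelGrad t w, v⟫ :=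
    funext fun z => (BMOInv.fderiv_heatKernel_apply t z v : _)
  rw [fderiv_heatExtension_apply_eq_convolution hg2 one_le_two ht y v, hK,
    BMOInv.inner_heatExtensionGrad_eq_convolution hg1 ht v y, ← convolution_flip, BMOInv.lsmul_flip]

omit [FiniteDimensional ℝ E] [MeasurableSpace E] [BorelSpace E] in
/-- `‖x‖ₑ² = Σᵢ ‖⟪x, bᵢ⟫‖ₑ²` for an orthonormal basis `b` (private copy of the helper of
`KochTataruSymbol.lean`, to keep the imports light). [folklore] -/
private theorem enorm_sq_eq_finset_sum_inner {ι : Type*} [Fintype ι] (b : OrthonormalBasis ι ℝ E) (x : E) :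
    ‖x‖ₑ ^ 2 = ∑ i, ‖⟪x, b i⟫‖ₑ ^ 2 := by
  rw [← ofReal_norm, ← ENNReal.ofReal_pow (norm_nonneg _), ← b.sum_sq_inner_left x,
    ENNReal.ofReal_sum_of_nonneg fun i _ => sq_nonneg _]
  refine Finset.sum_congr rfl fun i _ => ?_
  rw [Real.enorm_eq_ofReal_abs, ← ENNReal.ofReal_pow (abs_nonneg _), sq_abs]

/-- **The Frobenius norm of the caloric gradient, componentwise**: for `f ∈ L¹ ∩ L²(E; E)`,
`t > 0`, `|∇e^{tΔ}f(y)|²_F = Σⱼ ‖∇e^{tΔ}fⱼ(y)‖²`, `fⱼ = ⟪f, eⱼ⟫` (`eⱼ` the standard orthonormal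
basis). [folklore] -/
theorem frobeniusNormSq_fderiv_heatExtension_eq_sum {f : E → E} (hf1 : Integrable f)
    (hf2 : MemLp f 2 volume) {t : ℝ} (ht : 0 < t) (y : E) :
    frobeniusNormSq (fderiv ℝ (heatExtension f t) y) =
      ∑ j, ‖BMOInv.heatExtensionGrad (fun z => ⟪f z, stdOrthonormalBasis ℝ E j⟫) t y‖ ^ 2 := by
  unfold frobeniusNormSq
  set b := stdOrthonormalBasis ℝ E with hb
  have h1 : ∀ i, ‖fderiv ℝ (heatExtension f t) y (b i)‖ ^ 2 =
      ∑ j, (fderiv ℝ (heatExtension (fun z => ⟪f z, b j⟫) t) y (b i)) ^ 2 := by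
    intro i
    rw [← b.sum_sq_inner_left]
    refine Finset.sum_congr rfl fun j _ => ?_
    rw [inner_fderiv_heatExtension_apply hf2 one_le_two ht y (b i) (b j)]
  have h2 : ∀ i j, fderiv ℝ (heatExtension (fun z => ⟪f z, b j⟫) t) y (b i) =
      ⟪BMOInv.heatExtensionGrad (fun z => ⟪f z, b j⟫) t y, b i⟫ := fun i j =>
    fderiv_heatExtension_apply_eq_inner_heatExtensionGrad (hf1.inner_const (b j))
      (hf2.inner_const (b j)) ht y (b i)
  simp_rw [h1, h2]
  rw [Finset.sum_comm]
  exact Finset.sum_congr rfl fun j _ => b.sum_sq_inner_left _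

/-- **The vector energy inequality for the caloric extension**: for `f ∈ L¹ ∩ L²(E; E)`,
`∫₀^∞ ∫_E |∇e^{tΔ}f (y)|²_F dy dt ≤ ½ ∫ |f|²` (componentwise from the scalar energy inequality
`BMOInv.lintegral_Ioi_lintegral_enorm_heatExtensionGrad_sq_le`; classical:
`∫₀^∞‖∇e^{tΔ}f‖₂² = ½‖f‖₂² − lim ½‖e^{tΔ}f‖₂²`). [folklore] -/
theorem lintegral_Ioi_lintegral_frobeniusNormSq_fderiv_heatExtension_le {f : E → E}
    (hf1 : Integrable f) (hf2 : MemLp f 2 volume) :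
    ∫⁻ t in Ioi (0 : ℝ), ∫⁻ y, ENNReal.ofReal (frobeniusNormSq (fderiv ℝ (heatExtension f t) y)) ≤
      ENNReal.ofReal (1 / 2) * ∫⁻ y, ‖f y‖ₑ ^ 2 := by
  set b := stdOrthonormalBasis ℝ E with hb
  set fj : Fin (Module.finrank ℝ E) → E → ℝ := fun j z => ⟪f z, b j⟫ with hfj
  have hfj1 : ∀ j, Integrable (fj j) := fun j => hf1.inner_const (b j)
  have hfj2 : ∀ j, MemLp (fj j) 2 volume := fun j => hf2.inner_const (b j)
  have hmeas : ∀ j, Measurable fun q : ℝ × E => ‖BMOInv.heatExtensionGrad (fj j) q.1 q.2‖ₑ ^ 2 :=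
    fun j => (BMOInv.measurable_heatExtensionGrad (hfj1 j).aestronglyMeasurable).enorm.pow_const 2
  have hpt : ∀ t ∈ Ioi (0 : ℝ),
      (∫⁻ y, ENNReal.ofReal (frobeniusNormSq (fderiv ℝ (heatExtension f t) y))) =
        ∑ j, ∫⁻ y, ‖BMOInv.heatExtensionGrad (fj j) t y‖ₑ ^ 2 := by
    intro t ht
    have hm : ∀ j, AEMeasurable (fun y => ‖BMOInv.heatExtensionGrad (fj j) t y‖ₑ ^ 2) volume :=
      fun j => ((hmeas j).comp measurable_prodMk_left).aemeasurable
    rw [← lintegral_finsetSum' _ fun j _ => hm j]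
    refine lintegral_congr fun y => ?_
    rw [frobeniusNormSq_fderiv_heatExtension_eq_sum hf1 hf2 ht y,
      ENNReal.ofReal_sum_of_nonneg fun j _ => sq_nonneg _]
    refine Finset.sum_congr rfl fun j _ => ?_
    rw [← ofReal_norm, ENNReal.ofReal_pow (norm_nonneg _)]
  calc ∫⁻ t in Ioi (0 : ℝ), ∫⁻ y, ENNReal.ofReal (frobeniusNormSq (fderiv ℝ (heatExtension f t) y))
      = ∫⁻ t in Ioi (0 : ℝ), ∑ j, ∫⁻ y, ‖BMOInv.heatExtensionGrad (fj j) t y‖ₑ ^ 2 :=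
        setLIntegral_congr_fun measurableSet_Ioi hpt
    _ = ∑ j, ∫⁻ t in Ioi (0 : ℝ), ∫⁻ y, ‖BMOInv.heatExtensionGrad (fj j) t y‖ₑ ^ 2 :=
        lintegral_finsetSum' _ fun j _ => (hmeas j).lintegral_prod_right'.aemeasurable
    _ ≤ ∑ j, ENNReal.ofReal (1 / 2) * ∫⁻ y, ‖fj j y‖ₑ ^ 2 :=
        Finset.sum_le_sum fun j _ =>
          BMOInv.lintegral_Ioi_lintegral_enorm_heatExtensionGrad_sq_le (hfj1 j) (hfj2 j)
    _ = ENNReal.ofReal (1 / 2) * ∫⁻ y, ‖f y‖ₑ ^ 2 := by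
        rw [← Finset.mul_sum, ← lintegral_finsetSum' _ fun j _ =>
          ((hfj1 j).aestronglyMeasurable.aemeasurable.enorm.pow_const 2)]
        congr 1
        exact lintegral_congr fun y => (enorm_sq_eq_finset_sum_inner b (f y)).symm

/-- **The global enstrophy box bound for `L¹ ∩ L²` data**: for `f ∈ L¹ ∩ L²(E; E)` and any box
`(0,T) × S`, `∫₀ᵀ∫_S |∇e^{tΔ}f|²_F ≤ ½ ∫ |f|²`. [folklore] -/
theorem lintegral_box_frobeniusNormSq_fderiv_heatExtension_le {f : E → E} (hf1 : Integrable f)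
    (hf2 : MemLp f 2 volume) (T : ℝ) (S : Set E) :
    ∫⁻ z in Ioo 0 T ×ˢ S, ENNReal.ofReal (frobeniusNormSq (fderiv ℝ (heatExtension f z.1) z.2)) ≤
      ENNReal.ofReal (1 / 2) * ∫⁻ y, ‖f y‖ₑ ^ 2 := by
  have hμ : (volume : Measure (ℝ × E)).restrict (Ioi 0 ×ˢ univ) =
      ((volume : Measure ℝ).restrict (Ioi 0)).prod (volume : Measure E) := by
    rw [Measure.volume_eq_prod, ← Measure.prod_restrict, Measure.restrict_univ]
  calc ∫⁻ z in Ioo 0 T ×ˢ S, ENNReal.ofReal (frobeniusNormSq (fderiv ℝ (heatExtension f z.1) z.2))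
      ≤ ∫⁻ z in Ioi 0 ×ˢ univ,
          ENNReal.ofReal (frobeniusNormSq (fderiv ℝ (heatExtension f z.1) z.2)) :=
        lintegral_mono_set (prod_mono Ioo_subset_Ioi_self (subset_univ _))
    _ ≤ ∫⁻ t in Ioi (0 : ℝ), ∫⁻ y,
          ENNReal.ofReal (frobeniusNormSq (fderiv ℝ (heatExtension f t) y)) := by
        rw [hμ]
        exact lintegral_prod_le _
    _ ≤ _ := lintegral_Ioi_lintegral_frobeniusNormSq_fderiv_heatExtension_le hf1 hf2

end Energy

/-! ### The far field -/

section Far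

omit [InnerProductSpace ℝ E] [FiniteDimensional ℝ E] [MeasurableSpace E] [BorelSpace E] in
/-- **Off the doubled ball, `|w|^{-(d+1)}` is dominated by the Japanese bracket**: for
`‖w‖ ≥ 2R > 0`, `(‖w‖^{d+1})⁻¹ ≤ (1 + (2R)⁻¹)^{d+1} (1 + ‖w‖)^{-(d+1)}`. [folklore] -/
theorem inv_norm_pow_le_japaneseBracket {w : E} {R : ℝ} (hR : 0 < R) (hw : 2 * R ≤ ‖w‖) (n : ℕ) :
    (‖w‖ ^ n)⁻¹ ≤ (1 + (2 * R)⁻¹) ^ n * (1 + ‖w‖) ^ (-(n : ℝ)) := by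
  have hw0 : 0 < ‖w‖ := by linarith
  have h1 : 1 + ‖w‖ ≤ ‖w‖ * (1 + (2 * R)⁻¹) := by
    rw [mul_add, mul_one]
    have : 1 ≤ ‖w‖ * (2 * R)⁻¹ := by
      rw [← div_eq_mul_inv, le_div_iff₀ (by linarith)]; linarith
    linarith
  have h2 : (1 + ‖w‖) ^ n ≤ ‖w‖ ^ n * (1 + (2 * R)⁻¹) ^ n := by
    rw [← mul_pow]; exact pow_le_pow_left₀ (by positivity) h1 n
  rw [Real.rpow_neg (by positivity), Real.rpow_natCast, ← div_eq_mul_inv,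
    le_div_iff₀ (by positivity), inv_mul_eq_div, div_le_iff₀ (by positivity)]
  calc (1 + ‖w‖) ^ n ≤ ‖w‖ ^ n * (1 + (2 * R)⁻¹) ^ n := h2
    _ = (1 + (2 * R)⁻¹) ^ n * ‖w‖ ^ n := mul_comm _ _

variable (E) in
omit [FiniteDimensional ℝ E] [MeasurableSpace E] [BorelSpace E] in
/-- The far-field constant `2 (d+2)! 2^{d+1}` of `BMOInv.norm_heatKernelGrad_sub_le_far`. [folklore] -/
theorem far_kernel_const_nonneg :
    (0 : ℝ) ≤ 2 * (Module.finrank ℝ E + 2).factorial * 2 ^ (Module.finrank ℝ E + 1) := by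
  positivity

/-- **The far-field bound for the caloric gradient**: let `h ∈ L^q(E; F)` (`1 ≤ q`) with
`‖h‖ ≤ M` and `h = 0` on `B_{2R}(x₀)`, `R > 0`. Then for `t > 0`, `y ∈ B_R(x₀)` and `v ∈ E`,
`‖∂ᵥe^{tΔ}h(y)‖ ≤ ‖v‖ · M · 2(d+2)! 2^{d+1} · (1+(2R)⁻¹)^{d+1} · ∫ (1+‖w‖)^{-(d+1)} dw`,
uniformly in `t` (Grafakos, proof of Thm 3.3.8 (b), far part: `‖∇K_t(y−z)‖ ≤ C‖z−x₀‖^{-(d+1)}`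
for `z ∉ B_{2R}(x₀)`). [cite: GrafakosMFA2014, Theorem 3.3.8 (b)] -/
theorem enorm_fderiv_heatExtension_apply_le_far {F : Type*} [NormedAddCommGroup F]
    [NormedSpace ℝ F] {h : E → F} {q : ℝ≥0∞} (hq : MemLp h q volume)
    (h1q : 1 ≤ q) {M : ℝ} (hM : ∀ z, ‖h z‖ ≤ M) {x₀ : E} {R : ℝ} (hR : 0 < R)
    (h0 : ∀ z ∈ ball x₀ (2 * R), h z = 0) {t : ℝ} (ht : 0 < t) {y : E} (hy : y ∈ ball x₀ R)
    (v : E) :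
    ‖fderiv ℝ (heatExtension h t) y v‖ₑ ≤
      ‖v‖ₑ * (ENNReal.ofReal M *
        ENNReal.ofReal (2 * (Module.finrank ℝ E + 2).factorial * 2 ^ (Module.finrank ℝ E + 1)) *
        ENNReal.ofReal ((1 + (2 * R)⁻¹) ^ (Module.finrank ℝ E + 1)) *
        ∫⁻ w : E, ENNReal.ofReal ((1 + ‖w‖) ^ (-(Module.finrank ℝ E + 1 : ℝ)))) := by
  set d := Module.finrank ℝ E with hd
  set A : ℝ := 2 * (d + 2).factorial * 2 ^ (d + 1) with hA
  have hA0 : 0 ≤ A := far_kernel_const_nonneg E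
  set cR : ℝ := (1 + (2 * R)⁻¹) ^ (d + 1) with hcR
  have hM0 : 0 ≤ M := (norm_nonneg _).trans (hM x₀)
  -- the integral formula for the derivative
  rw [fderiv_heatExtension_apply_eq_integral ht hq h1q y v]
  refine (enorm_integral_le_lintegral_enorm _).trans ?_
  -- the integrand vanishes on the doubled ball
  set Φ : E → ℝ≥0∞ := fun z =>
    ‖((-(1 / (2 * t)) * ⟪y - z, v⟫) * heatKernel t (y - z)) • h z‖ₑ with hΦ
  have hind : Φ = (ball x₀ (2 * R))ᶜ.indicator Φ := by
    funext z
    by_cases hz : z ∈ ball x₀ (2 * R)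
    · rw [indicator_of_notMem (fun h' => absurd hz h'), hΦ]
      simp [h0 z hz]
    · rw [indicator_of_mem hz]
  have hstep1 : ∫⁻ z, Φ z = ∫⁻ z in (ball x₀ (2 * R))ᶜ, Φ z := by
    conv_lhs => rw [hind]
    exact lintegral_indicator measurableSet_ball.compl Φ
  -- pointwise bound off the doubled ball
  have hpt : ∀ z ∈ (ball x₀ (2 * R))ᶜ, Φ z ≤
      ‖v‖ₑ * (ENNReal.ofReal M * ENNReal.ofReal A * ENNReal.ofReal cR *
        ENNReal.ofReal ((1 + ‖z - x₀‖) ^ (-(d + 1 : ℝ)))) := by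
    intro z hz
    have hzx : 2 * R ≤ ‖z - x₀‖ := by
      rw [mem_compl_iff, mem_ball_iff_norm, not_lt] at hz; exact hz
    have hK : ‖(-(1 / (2 * t)) * ⟪y - z, v⟫) * heatKernel t (y - z)‖ ≤
        ‖BMOInv.heatKernelGrad t (y - z)‖ * ‖v‖ := by
      rw [BMOInv.norm_heatKernelGrad ht, norm_mul, norm_mul, norm_neg,
        Real.norm_of_nonneg (heatKernel_pos ht _).le, Real.norm_of_nonneg (by positivity : (0:ℝ) ≤ 1 / (2 * t))]
      have hcs : ‖⟪y - z, v⟫‖ ≤ ‖y - z‖ * ‖v‖ := norm_inner_le_norm _ _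
      have hKp : 0 ≤ heatKernel t (y - z) := (heatKernel_pos ht _).le
      calc 1 / (2 * t) * ‖⟪y - z, v⟫‖ * heatKernel t (y - z)
          ≤ 1 / (2 * t) * (‖y - z‖ * ‖v‖) * heatKernel t (y - z) := by gcongr
        _ = (2 * t)⁻¹ * BMOInv.heatKernel t (y - z) * ‖y - z‖ * ‖v‖ := by
            rw [show BMOInv.heatKernel t (y - z) = heatKernel t (y - z) from rfl]; ring
    have hfar := BMOInv.norm_heatKernelGrad_sub_le_far ht hR hy (show z ∉ ball x₀ (2 * R) from hz)
    rw [← hd, ← hA] at hfar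
    have hbr := inv_norm_pow_le_japaneseBracket hR hzx (d + 1)
    rw [← hcR] at hbr
    have hreal : ‖((-(1 / (2 * t)) * ⟪y - z, v⟫) * heatKernel t (y - z)) • h z‖ ≤
        ‖v‖ * (M * A * cR * (1 + ‖z - x₀‖) ^ (-(d + 1 : ℝ))) := by
      rw [norm_smul]
      have hbr0 : 0 ≤ (1 + ‖z - x₀‖) ^ (-(d + 1 : ℝ)) := by positivity
      calc ‖(-(1 / (2 * t)) * ⟪y - z, v⟫) * heatKernel t (y - z)‖ * ‖h z‖
          ≤ (‖BMOInv.heatKernelGrad t (y - z)‖ * ‖v‖) * M :=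
            mul_le_mul hK (hM z) (norm_nonneg _) (by positivity)
        _ ≤ (A * (‖z - x₀‖ ^ (d + 1))⁻¹ * ‖v‖) * M := by gcongr
        _ ≤ (A * (cR * (1 + ‖z - x₀‖) ^ (-(d + 1 : ℝ))) * ‖v‖) * M := by
            push_cast at hbr ⊢
            gcongr
        _ = ‖v‖ * (M * A * cR * (1 + ‖z - x₀‖) ^ (-(d + 1 : ℝ))) := by ring
    calc Φ z = ENNReal.ofReal ‖((-(1 / (2 * t)) * ⟪y - z, v⟫) * heatKernel t (y - z)) • h z‖ := by
          rw [hΦ, ofReal_norm]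
      _ ≤ ENNReal.ofReal (‖v‖ * (M * A * cR * (1 + ‖z - x₀‖) ^ (-(d + 1 : ℝ)))) :=
          ENNReal.ofReal_le_ofReal hreal
      _ = _ := by
          rw [ENNReal.ofReal_mul (norm_nonneg _), ofReal_norm,
            ENNReal.ofReal_mul (by positivity), ENNReal.ofReal_mul (by positivity),
            ENNReal.ofReal_mul hM0]
  -- integrate
  calc ∫⁻ z, Φ z = ∫⁻ z in (ball x₀ (2 * R))ᶜ, Φ z := hstep1
    _ ≤ ∫⁻ z in (ball x₀ (2 * R))ᶜ, ‖v‖ₑ * (ENNReal.ofReal M * ENNReal.ofReal A *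
          ENNReal.ofReal cR * ENNReal.ofReal ((1 + ‖z - x₀‖) ^ (-(d + 1 : ℝ)))) :=
        setLIntegral_mono' measurableSet_ball.compl hpt
    _ ≤ ∫⁻ z, ‖v‖ₑ * (ENNReal.ofReal M * ENNReal.ofReal A *
          ENNReal.ofReal cR * ENNReal.ofReal ((1 + ‖z - x₀‖) ^ (-(d + 1 : ℝ)))) :=
        setLIntegral_le_lintegral _ _
    _ = ‖v‖ₑ * (ENNReal.ofReal M * ENNReal.ofReal A * ENNReal.ofReal cR *
          ∫⁻ z, ENNReal.ofReal ((1 + ‖z - x₀‖) ^ (-(d + 1 : ℝ)))) := by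
        rw [lintegral_const_mul' _ _ enorm_ne_top, lintegral_const_mul' _ _ (by
          exact ENNReal.mul_ne_top (ENNReal.mul_ne_top ENNReal.ofReal_ne_top ENNReal.ofReal_ne_top)
            ENNReal.ofReal_ne_top)]
    _ = _ := by
        rw [lintegral_sub_right_eq_self (fun w : E => ENNReal.ofReal ((1 + ‖w‖) ^ (-(d + 1 : ℝ)))) x₀]

end Far

/-! ### The near/far splitting per box for bounded `L^q` data -/

section Boxes

/-- **The far-field constant is finite**: for `M` and `R > 0` there is `K < ∞` (namely
`M · 2(d+2)! 2^{d+1} (1+(2R)⁻¹)^{d+1} ∫(1+|w|)^{-(d+1)}`) such that every `h ∈ L^q(E; E)` with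
`|h| ≤ M` vanishing on `B_{2R}(x₀)` has `‖∂ᵥe^{tΔ}h(y)‖ ≤ ‖v‖ K` on `B_R(x₀)`, uniformly in
`t > 0` and `x₀` (`enorm_fderiv_heatExtension_apply_le_far` and Mathlib's
`finite_integral_one_add_norm`). [folklore] -/
theorem exists_far_const (M : ℝ) {R : ℝ} (hR : 0 < R) :
    ∃ K : ℝ≥0∞, K ≠ ⊤ ∧ ∀ {h : E → E} {q : ℝ≥0∞}, MemLp h q volume → 1 ≤ q →
      (∀ z, ‖h z‖ ≤ M) → ∀ {x₀ : E}, (∀ z ∈ ball x₀ (2 * R), h z = 0) →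
      ∀ {t : ℝ}, 0 < t → ∀ {y : E}, y ∈ ball x₀ R → ∀ v : E,
        ‖fderiv ℝ (heatExtension h t) y v‖ₑ ≤ ‖v‖ₑ * K := by
  refine ⟨ENNReal.ofReal M *
      ENNReal.ofReal (2 * (Module.finrank ℝ E + 2).factorial * 2 ^ (Module.finrank ℝ E + 1)) *
      ENNReal.ofReal ((1 + (2 * R)⁻¹) ^ (Module.finrank ℝ E + 1)) *
      ∫⁻ w : E, ENNReal.ofReal ((1 + ‖w‖) ^ (-(Module.finrank ℝ E + 1 : ℝ))), ?_, ?_⟩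
  · refine ENNReal.mul_ne_top (ENNReal.mul_ne_top (ENNReal.mul_ne_top ENNReal.ofReal_ne_top
      ENNReal.ofReal_ne_top) ENNReal.ofReal_ne_top) ?_
    have h := finite_integral_one_add_norm (E := E) (μ := volume)
      (r := (Module.finrank ℝ E + 1 : ℝ)) (by linarith)
    exact h.ne
  · intro h q hq h1q hM x₀ h0 t ht y hy v
    exact enorm_fderiv_heatExtension_apply_le_far hq h1q hM hR h0 ht hy v

omit [MeasurableSpace E] [BorelSpace E] in
/-- `ENNReal.ofReal` of the Frobenius norm squared is the sum of the squared `enorm`s of the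
columns (private variant of the helper of `NSWeakStrongUniquenessProofs.lean`). [folklore] -/
private theorem ofReal_frobeniusNormSq_eq_sum_enorm_sq (L : E →L[ℝ] E) :
    ENNReal.ofReal (frobeniusNormSq L) = ∑ i, ‖L (stdOrthonormalBasis ℝ E i)‖ₑ ^ 2 := by
  unfold frobeniusNormSq
  rw [ENNReal.ofReal_sum_of_nonneg fun i _ => sq_nonneg _]
  refine Finset.sum_congr rfl fun i _ => ?_
  rw [← ofReal_norm, ENNReal.ofReal_pow (norm_nonneg _)]

/-- **The far piece has bounded Frobenius gradient on the box**: with `K` as in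
`exists_far_const`, `|∇e^{tΔ}h(y)|²_F ≤ d K²` on `B_R(x₀)`. [folklore] -/
theorem ofReal_frobeniusNormSq_le_of_far {K : ℝ≥0∞} {h : E → E} {t : ℝ} {y : E}
    (hK : ∀ v : E, ‖fderiv ℝ (heatExtension h t) y v‖ₑ ≤ ‖v‖ₑ * K) :
    ENNReal.ofReal (frobeniusNormSq (fderiv ℝ (heatExtension h t) y)) ≤
      Module.finrank ℝ E • K ^ 2 := by
  rw [ofReal_frobeniusNormSq_eq_sum_enorm_sq]
  calc ∑ i, ‖fderiv ℝ (heatExtension h t) y (stdOrthonormalBasis ℝ E i)‖ₑ ^ 2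
      ≤ ∑ _i : Fin (Module.finrank ℝ E), K ^ 2 := by
        refine Finset.sum_le_sum fun i _ => ?_
        have h1 := hK (stdOrthonormalBasis ℝ E i)
        rw [← ofReal_norm (stdOrthonormalBasis ℝ E i), (stdOrthonormalBasis ℝ E).orthonormal.1 i,
          ENNReal.ofReal_one, one_mul] at h1
        exact pow_le_pow_left' h1 2
    _ = Module.finrank ℝ E • K ^ 2 := by
        rw [Finset.sum_const, Finset.card_univ, Fintype.card_fin]

/-- The Frobenius norm of the caloric gradient of `Lᵖ` data is continuous on the open slab
`(0,∞) × E`. [folklore] -/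
theorem continuousOn_frobeniusNormSq_fderiv_heatExtension {g : E → E} {p : ℝ≥0∞}
    (hg : MemLp g p volume) (hp : 1 ≤ p) :
    ContinuousOn (fun z : ℝ × E => frobeniusNormSq (fderiv ℝ (heatExtension g z.1) z.2))
      (Ioi 0 ×ˢ univ) := by
  have hc : Continuous fun L : E →L[ℝ] E => frobeniusNormSq L := by
    unfold frobeniusNormSq; fun_prop
  refine hc.comp_continuousOn ?_
  exact continuousOn_clm_apply.2 fun v => continuousOn_uncurry_fderiv_heatExtension_of_memLp hg hp v

/-- A.e.-measurability of the Frobenius norm of the caloric gradient of `Lᵖ` data on a box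
`(0,T) × S`. [folklore] -/
theorem aemeasurable_ofReal_frobeniusNormSq_fderiv_heatExtension {g : E → E} {p : ℝ≥0∞}
    (hg : MemLp g p volume) (hp : 1 ≤ p) (T : ℝ) {S : Set E} (hS : MeasurableSet S) :
    AEMeasurable (fun z : ℝ × E =>
        ENNReal.ofReal (frobeniusNormSq (fderiv ℝ (heatExtension g z.1) z.2)))
      (volume.restrict (Ioo 0 T ×ˢ S)) :=
  (((continuousOn_frobeniusNormSq_fderiv_heatExtension hg hp).mono
    (prod_mono Ioo_subset_Ioi_self (subset_univ _))).aemeasurable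
      (measurableSet_Ioo.prod hS)).ennreal_ofReal

/-- **The near piece**: for `|h| ≤ M` a.e.-strongly measurable, `h𝟙_{B_ρ(x₀)}` is integrable,
in `L²`, and `∫ |h𝟙_{B_ρ(x₀)}|² ≤ M² |B_ρ|`. [folklore] -/
theorem near_piece_bounds {h : E → E} (hh : AEStronglyMeasurable h volume) {M : ℝ}
    (hM : ∀ z, ‖h z‖ ≤ M) (x₀ : E) (ρ : ℝ) :
    Integrable ((ball x₀ ρ).indicator h) ∧ MemLp ((ball x₀ ρ).indicator h) 2 volume ∧
      ∫⁻ z, ‖(ball x₀ ρ).indicator h z‖ₑ ^ 2 ≤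
        ENNReal.ofReal (M ^ 2) * volume (ball (0 : E) ρ) := by
  have hM0 : 0 ≤ M := (norm_nonneg _).trans (hM x₀)
  have hmeas : AEStronglyMeasurable ((ball x₀ ρ).indicator h) volume := hh.indicator measurableSet_ball
  have hdom : ∀ z, ‖(ball x₀ ρ).indicator h z‖ ≤ ‖(ball x₀ ρ).indicator (fun _ => M) z‖ := by
    intro z
    by_cases hz : z ∈ ball x₀ ρ
    · rw [indicator_of_mem hz, indicator_of_mem hz, Real.norm_of_nonneg hM0]; exact hM z
    · rw [indicator_of_notMem hz, indicator_of_notMem hz, norm_zero, norm_zero]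
  have hconst1 : Integrable ((ball x₀ ρ).indicator fun _ : E => M) volume :=
    (integrable_indicator_iff measurableSet_ball).2
      (integrableOn_const (hs := measure_ball_lt_top.ne))
  have hconst2 : MemLp ((ball x₀ ρ).indicator fun _ : E => M) 2 volume :=
    memLp_indicator_const 2 measurableSet_ball M (Or.inr measure_ball_lt_top.ne)
  refine ⟨hconst1.mono' hmeas (Eventually.of_forall fun z => (hdom z).trans (le_of_eq
      (Real.norm_of_nonneg (indicator_nonneg (fun _ _ => hM0) z)))),
    hconst2.of_le hmeas (Eventually.of_forall hdom), ?_⟩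
  · have hind : (fun z => ‖(ball x₀ ρ).indicator h z‖ₑ ^ 2) =
        (ball x₀ ρ).indicator fun z => ‖h z‖ₑ ^ 2 := by
      funext z
      by_cases hz : z ∈ ball x₀ ρ
      · rw [indicator_of_mem hz, indicator_of_mem hz]
      · rw [indicator_of_notMem hz, indicator_of_notMem hz]; simp
    rw [hind, lintegral_indicator measurableSet_ball, ← Measure.addHaar_ball_center volume x₀ ρ,
      ← setLIntegral_const]
    refine lintegral_mono fun z => ?_
    rw [← ofReal_norm, ← ENNReal.ofReal_pow (norm_nonneg _)]
    exact ENNReal.ofReal_le_ofReal (pow_le_pow_left₀ (norm_nonneg _) (hM z) 2)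

/-- **The enstrophy box bound for bounded `L^q` data, near/far splitting** (Lemarié-Rieusset
2016, proof of Thm 14.1, Step 1, (14.5); Grafakos, proof of Thm 3.3.8 (b)): let `h ∈ L^q(E; E)`,
`1 ≤ q`, `|h| ≤ M`, `R > 0`, and let `K` be a far-field constant for `(M, R)` as in
`exists_far_const`. Then for every `x₀` and `T`,
`∫₀ᵀ∫_{B_R(x₀)} |∇e^{tΔ}h|²_F ≤ 2 · ½ M²|B_{2R}| + 2 d K² |(0,T) × B_R|`. [cite: LemarieRieusset2016, Theorem 14.1 (proof, Step 1, (14.5))] -/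
theorem lintegral_box_frobeniusNormSq_le_of_bound {h : E → E} {q : ℝ≥0∞} (hq : MemLp h q volume)
    (h1q : 1 ≤ q) {M : ℝ} (hM : ∀ z, ‖h z‖ ≤ M) {R : ℝ} {K : ℝ≥0∞}
    (hK : ∀ {g : E → E} {q' : ℝ≥0∞}, MemLp g q' volume → 1 ≤ q' →
      (∀ z, ‖g z‖ ≤ M) → ∀ {x₀ : E}, (∀ z ∈ ball x₀ (2 * R), g z = 0) →
      ∀ {t : ℝ}, 0 < t → ∀ {y : E}, y ∈ ball x₀ R → ∀ v : E,
        ‖fderiv ℝ (heatExtension g t) y v‖ₑ ≤ ‖v‖ₑ * K)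
    (x₀ : E) (T : ℝ) :
    ∫⁻ z in Ioo 0 T ×ˢ ball x₀ R,
        ENNReal.ofReal (frobeniusNormSq (fderiv ℝ (heatExtension h z.1) z.2)) ≤
      2 * (ENNReal.ofReal (1 / 2) * (ENNReal.ofReal (M ^ 2) * volume (ball (0 : E) (2 * R)))) +
        2 * ((Module.finrank ℝ E • K ^ 2) * (volume (Ioo (0 : ℝ) T) * volume (ball (0 : E) R))) := by
  have hM0 : 0 ≤ M := (norm_nonneg _).trans (hM x₀)
  -- the splitting
  set h₁ : E → E := (ball x₀ (2 * R)).indicator h with hh₁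
  set h₂ : E → E := (ball x₀ (2 * R))ᶜ.indicator h with hh₂
  have hh12 : h₁ + h₂ = h := indicator_self_add_compl _ _
  have hq1 : MemLp h₁ q volume := hq.indicator measurableSet_ball
  have hq2 : MemLp h₂ q volume := hq.indicator measurableSet_ball.compl
  obtain ⟨hint1, hL21, hnear⟩ := near_piece_bounds hq.1 hM x₀ (2 * R)
  have hM2 : ∀ z, ‖h₂ z‖ ≤ M := by
    intro z
    by_cases hz : z ∈ (ball x₀ (2 * R))ᶜ
    · rw [hh₂, indicator_of_mem hz]; exact hM z
    · rw [hh₂, indicator_of_notMem hz, norm_zero]; exact hM0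
  have h02 : ∀ z ∈ ball x₀ (2 * R), h₂ z = 0 := fun z hz =>
    indicator_of_notMem (fun h' => absurd hz h') _
  have hfun : ∀ t : ℝ, 0 < t → heatExtension h t = heatExtension h₁ t + heatExtension h₂ t := by
    intro t ht
    funext y
    rw [Pi.add_apply, ← heatExtension_add_apply_of_memLp hq1 hq2 h1q h1q ht y, hh12]
  have hfderiv : ∀ t : ℝ, 0 < t → ∀ y, fderiv ℝ (heatExtension h t) y =
      fderiv ℝ (heatExtension h₁ t) y + fderiv ℝ (heatExtension h₂ t) y := by
    intro t ht y
    rw [hfun t ht]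
    exact (((hasFDerivAt_heatExtension hq1 h1q ht y).differentiableAt.hasFDerivAt).add
      ((hasFDerivAt_heatExtension hq2 h1q ht y).differentiableAt.hasFDerivAt)).fderiv
  -- pointwise bound on the box
  have hpt : ∀ z ∈ Ioo 0 T ×ˢ ball x₀ R,
      ENNReal.ofReal (frobeniusNormSq (fderiv ℝ (heatExtension h z.1) z.2)) ≤
        2 * ENNReal.ofReal (frobeniusNormSq (fderiv ℝ (heatExtension h₁ z.1) z.2)) +
          2 * (Module.finrank ℝ E • K ^ 2) := by
    rintro ⟨t, y⟩ ⟨ht, hy⟩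
    have ht0 : 0 < t := ht.1
    dsimp only
    rw [hfderiv t ht0 y]
    refine (ENNReal.ofReal_le_ofReal (frobeniusNormSq_add_le _ _)).trans ?_
    rw [ENNReal.ofReal_add (by positivity [frobeniusNormSq_nonneg (fderiv ℝ (heatExtension h₁ t) y)])
      (by positivity [frobeniusNormSq_nonneg (fderiv ℝ (heatExtension h₂ t) y)]),
      ENNReal.ofReal_mul zero_le_two, ENNReal.ofReal_mul zero_le_two, ENNReal.ofReal_ofNat]
    gcongr
    exact ofReal_frobeniusNormSq_le_of_far fun v => hK hq2 h1q hM2 h02 ht0 hy v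
  have hvol : volume (Ioo 0 T ×ˢ ball x₀ R) = volume (Ioo (0 : ℝ) T) * volume (ball (0 : E) R) := by
    rw [← Measure.addHaar_ball_center volume x₀, Measure.volume_eq_prod, Measure.prod_prod]
  calc ∫⁻ z in Ioo 0 T ×ˢ ball x₀ R,
        ENNReal.ofReal (frobeniusNormSq (fderiv ℝ (heatExtension h z.1) z.2))
      ≤ ∫⁻ z in Ioo 0 T ×ˢ ball x₀ R,
          (2 * ENNReal.ofReal (frobeniusNormSq (fderiv ℝ (heatExtension h₁ z.1) z.2)) +
            2 * (Module.finrank ℝ E • K ^ 2)) :=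
        setLIntegral_mono' (measurableSet_Ioo.prod measurableSet_ball) hpt
    _ = 2 * (∫⁻ z in Ioo 0 T ×ˢ ball x₀ R,
          ENNReal.ofReal (frobeniusNormSq (fderiv ℝ (heatExtension h₁ z.1) z.2))) +
          2 * (Module.finrank ℝ E • K ^ 2) * volume (Ioo 0 T ×ˢ ball x₀ R) := by
        rw [lintegral_add_right _ measurable_const, setLIntegral_const,
          lintegral_const_mul'' _ ((aemeasurable_ofReal_frobeniusNormSq_fderiv_heatExtension hq1 h1q
            T measurableSet_ball))]
    _ ≤ 2 * (ENNReal.ofReal (1 / 2) * ∫⁻ y, ‖h₁ y‖ₑ ^ 2) +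
          2 * (Module.finrank ℝ E • K ^ 2) * volume (Ioo 0 T ×ˢ ball x₀ R) := by
        gcongr
        exact lintegral_box_frobeniusNormSq_fderiv_heatExtension_le hint1 hL21 T _
    _ ≤ _ := by
        rw [hvol, mul_assoc 2 (Module.finrank ℝ E • K ^ 2)]
        gcongr

/-- **Enstrophy box bound for `L¹ ∩ L²` data** in the form consumed by
`isCaloricLocalLerayField_heatExtension_of_memLp`: for `f ∈ L¹ ∩ L²(E; E)` and `R`, there is
`C < ∞` with `∫₀^{R²}∫_{B_R(x₀)} |∇e^{tΔ}f|²_F ≤ C` for all `x₀` (`C = ½‖f‖₂²`). [cite: LemarieRieusset2016, Theorem 14.1 (proof, Step 1, (14.5))] -/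
theorem exists_lintegral_box_frobeniusNormSq_le_of_integrable {f : E → E} (hf1 : Integrable f)
    (hf2 : MemLp f 2 volume) (R : ℝ) :
    ∃ C : ℝ≥0, ∀ x₀ : E, ∫⁻ z in Ioo 0 (R ^ 2) ×ˢ ball x₀ R,
      ENNReal.ofReal (frobeniusNormSq (fderiv ℝ (heatExtension f z.1) z.2)) ≤ C := by
  have hfin : ∫⁻ y, ‖f y‖ₑ ^ 2 < ⊤ := by
    have h := hf2.eLpNorm_lt_top
    rw [eLpNorm_eq_lintegral_rpow_enorm_toReal two_ne_zero ENNReal.ofNat_ne_top,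
      ENNReal.toReal_ofNat, one_div,
      ENNReal.rpow_lt_top_iff_of_pos (by norm_num : (0 : ℝ) < 2⁻¹)] at h
    refine lt_of_eq_of_lt (lintegral_congr fun y => ?_) h
    rw [ENNReal.rpow_two]
  refine ⟨(ENNReal.ofReal (1 / 2) * ∫⁻ y, ‖f y‖ₑ ^ 2).toNNReal, fun x₀ => ?_⟩
  rw [ENNReal.coe_toNNReal (ENNReal.mul_ne_top ENNReal.ofReal_ne_top hfin.ne)]
  exact lintegral_box_frobeniusNormSq_fderiv_heatExtension_le hf1 hf2 _ _

/-- **Enstrophy box bound for bounded `L^q` data** in the form consumed by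
`isCaloricLocalLerayField_heatExtension_of_memLp`: for `h ∈ L^q(E; E)`, `1 ≤ q`, `|h| ≤ M` and
`R > 0`, there is `C < ∞` with `∫₀^{R²}∫_{B_R(x₀)} |∇e^{tΔ}h|²_F ≤ C` for all `x₀`. [cite: LemarieRieusset2016, Theorem 14.1 (proof, Step 1, (14.5))] -/
theorem exists_lintegral_box_frobeniusNormSq_le_of_bound {h : E → E} {q : ℝ≥0∞}
    (hq : MemLp h q volume) (h1q : 1 ≤ q) {M : ℝ} (hM : ∀ z, ‖h z‖ ≤ M) {R : ℝ} (hR : 0 < R) :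
    ∃ C : ℝ≥0, ∀ x₀ : E, ∫⁻ z in Ioo 0 (R ^ 2) ×ˢ ball x₀ R,
      ENNReal.ofReal (frobeniusNormSq (fderiv ℝ (heatExtension h z.1) z.2)) ≤ C := by
  obtain ⟨K, hKtop, hK⟩ := exists_far_const (E := E) M hR
  set C : ℝ≥0∞ := 2 * (ENNReal.ofReal (1 / 2) * (ENNReal.ofReal (M ^ 2) * volume (ball (0 : E) (2 * R)))) +
    2 * ((Module.finrank ℝ E • K ^ 2) * (volume (Ioo (0 : ℝ) (R ^ 2)) * volume (ball (0 : E) R)))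
    with hC
  have hCtop : C ≠ ⊤ := by
    refine ENNReal.add_ne_top.2 ⟨ENNReal.mul_ne_top ENNReal.ofNat_ne_top
      (ENNReal.mul_ne_top ENNReal.ofReal_ne_top
        (ENNReal.mul_ne_top ENNReal.ofReal_ne_top measure_ball_lt_top.ne)), ?_⟩
    refine ENNReal.mul_ne_top ENNReal.ofNat_ne_top (ENNReal.mul_ne_top ?_
      (ENNReal.mul_ne_top measure_Ioo_lt_top.ne measure_ball_lt_top.ne))
    rw [nsmul_eq_mul]
    exact ENNReal.mul_ne_top (ENNReal.natCast_ne_top _) (ENNReal.pow_ne_top hKtop)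
  refine ⟨C.toNNReal, fun x₀ => ?_⟩
  rw [ENNReal.coe_toNNReal hCtop]
  exact lintegral_box_frobeniusNormSq_le_of_bound hq h1q hM hK x₀ (R ^ 2)

end Boxes

end Literature.Analysis.FluidPDE
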